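import Summits.Ventures.CertifiedQuantumChemistry.Rows.HubbardRingKernel
import Summits.Ventures.CertifiedQuantumChemistry.Rows.HubbardRingTVScaleHomogeneity
import Summits.Ventures.CertifiedQuantumChemistry.Rows.TwoElectronSectorsExact
import Summits.Ventures.CertifiedQuantumChemistry.Rows.OneElectronSectorsExact
import HarnessLib

/-!
# Ventures/CertifiedQuantumChemistry — Rows/HubbardDimerExact.lean: THE HUBBARD DIMER IN CLOSED FORM —
# `E₀(hubbardRingTV 2 t U; 1, 1) = (U − √(U² + 16t²))/2` by a kernel-checked sum of squares in Lieb's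
# two-species coordinates, hence the cell's sector DQG value (exact on the dimer) has this closed form for
# ALL couplings, and so does the singlet-restricted value for `U > 0`; `U·E₀ → −4` as `U → ∞`

HONEST FRAMING (verbatim): certified bounds for a stated model Hamiltonian in a stated basis; not a
claim about the real molecule beyond that model.

Seat rdm-B, ROWS courtesy file (theorems only; no `def`, no notation, no instance; zero compute; the
dimer tables `![{0}, {1}]`, `![![0, −1], ![−1, 0]]`, `![![1, 0], ![0, 1]]` are written inline). The smallest
member `L = 2` of the cell's model family `hubbardRingTV L t U` (single bond `0 ~ 1`, half filling
`(N_α, N_β) = (1, 1)`, sector dimension `4`) is the textbook two-site Hubbard model, whose ground energy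
`(U − √(U² + 16t²))/2` every strong-coupling expansion starts from (`≈ −4t²/U = −J`). Using the typer's
kernel assembly `Rows/HubbardRingKernel.lean` (T-06 + `TwoSpecies.re_sector_hamiltonian_eq`:
`Re ⟨ψ, H ψ⟩ = hopForm K K W(ψ) + U·dblForm d W(ψ)` in sector coordinates) this file proves that value
EXACTLY in the Lean kernel — an SOS with the irrational constant `λ = (U − √(U²+16))/2`, not a rational
row slot — and, with this gen's `Rows/TwoElectronSectorsExact.lean`, turns it into the first closed-form
value of the cell's relaxation levels valid at every coupling:

* §1 tables (kernel-evaluated, `decide`): `isSubsetEnum_d2`, `hopInt_d2`, `card_d2_inter`,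
  `hoppingMatrix_d2` (`K = ![![0, −1], ![−1, 0]]`, `d = 1`).
* §2 the real forms: `nsqR_d2`, `dblR_d2` (`x₀₀² + x₁₁²`), `hopR_d2` (`−2(x₀₀ + x₁₁)(x₀₁ + x₁₀)`);
  `add_sqrt_pos`; **`formBound_d2`** — `λ·nsq(x) ≤ hop(x) + U·dbl(x)` for every real `U` and real array
  `x`, by the identity `2μ·(hop + U·dbl − λ·nsq) = (μ(x₀₀+x₁₁) − 2(x₀₁+x₁₀))² + μ²(x₀₀−x₁₁)² + 4(x₀₁−x₁₀)²`
  (`μ = (U + √(U²+16))/2 > 0`, `λμ = −4`; `linear_combination` on `√(U²+16)² = U² + 16`).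
* §3 **`le_energy`** (the form bound at the sector ground state's coordinates, real and imaginary parts),
  **`energy_le`** (Rayleigh–Ritz at the explicit vector with array `w₀₀ = w₁₁ = 2`, `w₀₁ = w₁₀ = μ`, on
  which `hop + U·dbl = λ·nsq`), **`energy_eq`**: `E₀(hubbardRingTV 2 1 U; 1, 1) = (U − √(U² + 16))/2` for
  every rational `U`; `energy_eq_of_pos`: `E₀(hubbardRingTV 2 t U; 1, 1) = (U − √(U² + 16t²))/2` for `t > 0`
  (scale homogeneity, gen 37).
* §4 **`pqgSectorEnergy_eq`** — `OPT_DQG(2; 1, U; 1, 1) = (U − √(U² + 16))/2` (all rational `U`);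
  **`pqgSingletEnergy_eq`** — `OPT_DQG+S²(2; 1, U; 1) =` the same (`U > 0`); `pqgSectorEnergy_eq_of_pos`
  (`t > 0`); `energy_mem_Icc` — the superexchange bracket `−4/U ≤ E₀ ≤ 0` (`U > 0`).
* §5 **`tendsto_mul_energy_two`** — `U·E₀(hubbardRingTV 2 1 U; 1, 1) → −4` as `U → ∞` along `ℚ` (the
  dimer's strong-coupling constant `−4·h(2)`, `h(2) = −⟨S₁·S₂ − ¼⟩ = 1`: `E₀ ≈ −J`), from the closed form
  (`tendsto_mul_closedForm`: `x(x − √(x²+16))/2 = −8/(1 + √(1 + 16/x²)) → −4`); the same for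
  `U·OPT_DQG(2; 1, U; 1, 1)` (`tendsto_mul_pqgSectorEnergy_two`) — compare the typer's T-K0-4
  `U·E₀(4; U) → −12` (`Rows/HubbardRingStrongCouplingLimit.lean`), here elementary.
* §6 **`pqgSectorEnergy_eq_energy_all`** — on the dimer the level-DQG programme has NO GAP IN ANY SECTOR:
  `OPT_DQG(2; t, U; a, b) = E₀(2; t, U; a, b)` for all `a, b ≤ 2`, `t, U` (vacuum / full band: gen 38's
  `Rows/HubbardRingTVVacuumSector.lean`; one electron / one hole: `Rows/OneElectronSectorsExact.lean`; two
  electrons = two holes: `Rows/TwoElectronSectorsExact.lean`).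

READING: an exact statement about the cell's model object at `L = 2` (outside S-U's range `L ≥ 4`) and
the values of the abstract programmes there; nothing here is a certificate, a row or a value of record of
`CERTIFIED.md`. All PROVED (0 sorry, standard axioms); no defs, no named facts. References
(docstring-only): E. H. Lieb, PRL 62 (1989) 1201, eq. (4) (two-species coordinates); the two-site
Hubbard model is textbook, e.g. P. Fazekas, *Lecture Notes on Electron Correlation and Magnetism* (World
Scientific 1999) §4.2, H. Tasaki, *Physics and Mathematics of Quantum Many-Body Systems* (2020) §9.2.
Tree (REUSED): `hubbardRingTV_sector_forms`, `IsSubsetEnum`, `hopInt`, `hoppingMatrix_eq_cast`,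
`ofSectorArray` / `coeffMatrix_ofSectorArray` / `isInSector_ofSectorArray`, `hopForm_eq_hopR` /
`dblForm_eq_dblR` / `normSqW_eq_nsqR` (the plaquette kernel file), `exists_unit_eigen_sectorGroundEnergy`,
`sectorGroundEnergy_le_of_rayleigh`, `hubbardRingTV_energy_scale` (gen 37),
`hubbardRingTV_two_pqgSectorEnergy_eq_energy` / `…pqgSingletEnergy_eq_energy`,
`hubbardRingTV_pqgSectorEnergy_eq_energy_one{Electron,Hole}` (this gen), `hubbardRingTV_{pqgSectorEnergy,energy}_{vacuum,full}`
(gen 38).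
-/

noncomputable section

namespace Summit.Ventures.CertifiedQuantumChemistry

open Matrix Finset
open Literature.MathematicalPhysics.QuantumLattice Literature.MathematicalPhysics.QuantumChemistry
open Literature.MathematicalPhysics.QuantumLattice.TwoSpecies
open Summit.Ventures.CertifiedQuantumChemistry.Hamiltonians
open Summit.HubbardSuperconductivity.HubbardSuperconductivity.Theorems.CooperPairDMottWalk
open scoped ComplexOrder

namespace Dimer

/-! ## §1 The literal tables of the dimer `L = 2`, sector `(1, 1)` (kernel evaluation) -/

/-- `![{0}, {1}]` enumerates the one-element subsets of `Fin 2`. [folklore] -/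
theorem isSubsetEnum_d2 : IsSubsetEnum 1 (![{0}, {1}] : Fin 2 → Finset (Fin 2)) where
  inj i j h := (by decide : ∀ i j : Fin 2,
    (![{0}, {1}] : Fin 2 → Finset (Fin 2)) i = (![{0}, {1}] : Fin 2 → Finset (Fin 2)) j → i = j) i j h
  image_eq := by decide +kernel

/-- The integer hopping entry of the 2-ring between one-element subsets: `hopInt = −K` with
`K = ![![0, −1], ![−1, 0]]` (one spinless fermion hops `0 ↔ 1` with Jordan–Wigner sign `+1`).
[folklore] -/
theorem hopInt_d2 : ∀ i j : Fin 2,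
    hopInt (ringGraph 2) ((![{0}, {1}] : Fin 2 → Finset (Fin 2)) i) ((![{0}, {1}] : Fin 2 → Finset (Fin 2)) j) =
      -((![![0, -1], ![-1, 0]] : Fin 2 → Fin 2 → ℤ) i j) := by
  decide +kernel

/-- Double occupancies `|{i} ∩ {j}| = [i = j]`. [folklore] -/
theorem card_d2_inter : ∀ i j : Fin 2,
    (((![{0}, {1}] : Fin 2 → Finset (Fin 2)) i) ∩ ((![{0}, {1}] : Fin 2 → Finset (Fin 2)) j)).card =
      (![![1, 0], ![0, 1]] : Fin 2 → Fin 2 → ℕ) i j := by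
  decide +kernel

/-- Hopping entries of the 2-ring (`t = 1`) between one-element subsets: `K = ![![0, −1], ![−1, 0]]`.
[folklore] -/
theorem hoppingMatrix_d2 (i j : Fin 2) :
    hoppingMatrix (ringGraph 2) 1 ((![{0}, {1}] : Fin 2 → Finset (Fin 2)) i)
        ((![{0}, {1}] : Fin 2 → Finset (Fin 2)) j) =
      (((![![0, -1], ![-1, 0]] : Fin 2 → Fin 2 → ℤ) i j : ℤ) : ℂ) := by
  rw [hoppingMatrix_eq_cast, hopInt_d2]; push_cast; ring

/-! ## §2 The real sector forms of the dimer and the exact lower bound of the form -/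

/-- The norm form on `2 × 2` arrays. [folklore] -/
theorem nsqR_d2 (x : Fin 2 → Fin 2 → ℝ) :
    nsqR x = x 0 0 ^ 2 + x 0 1 ^ 2 + x 1 0 ^ 2 + x 1 1 ^ 2 := by
  simp only [nsqR, Fin.sum_univ_two]
  ring

/-- The double-occupancy form of the dimer: `x₀₀² + x₁₁²`. [folklore] -/
theorem dblR_d2 (x : Fin 2 → Fin 2 → ℝ) :
    dblR (![![1, 0], ![0, 1]] : Fin 2 → Fin 2 → ℕ) x = x 0 0 ^ 2 + x 1 1 ^ 2 := by
  simp only [dblR, Fin.sum_univ_two, Matrix.cons_val_zero, Matrix.cons_val_one]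
  push_cast
  ring

/-- The hopping form of the dimer: `−2 (x₀₀ + x₁₁)(x₀₁ + x₁₀)` (doublon amplitudes against covalent
amplitudes). [folklore] -/
theorem hopR_d2 (x : Fin 2 → Fin 2 → ℝ) :
    hopR (![![0, -1], ![-1, 0]] : Fin 2 → Fin 2 → ℤ) (![![0, -1], ![-1, 0]] : Fin 2 → Fin 2 → ℤ) x =
      -2 * ((x 0 0 + x 1 1) * (x 0 1 + x 1 0)) := by
  simp only [hopR, Fin.sum_univ_two, Matrix.cons_val_zero, Matrix.cons_val_one]
  push_cast
  ring

/-- `U + √(U² + 16) > 0`. [folklore] -/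
theorem add_sqrt_pos (U : ℝ) : 0 < U + Real.sqrt (U ^ 2 + 16) := by
  have hs2 : Real.sqrt (U ^ 2 + 16) ^ 2 = U ^ 2 + 16 := Real.sq_sqrt (by positivity)
  have hs0 : 0 ≤ Real.sqrt (U ^ 2 + 16) := Real.sqrt_nonneg _
  by_contra h
  push Not at h
  nlinarith [mul_nonneg hs0 (by linarith : 0 ≤ -U - Real.sqrt (U ^ 2 + 16))]

/-- **THE EXACT LOWER BOUND OF THE DIMER FORM**: for every real `U` and every real `2 × 2` array `x`,
`λ(U)·nsq(x) ≤ hop(x) + U·dbl(x)` with `λ(U) = (U − √(U² + 16))/2`, by the sum of squares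
`2μ·(hop + U·dbl − λ·nsq) = (μ(x₀₀+x₁₁) − 2(x₀₁+x₁₀))² + μ²(x₀₀−x₁₁)² + 4(x₀₁−x₁₀)²`, `μ = (U + √(U²+16))/2`,
`λμ = −4`. [folklore] -/
theorem formBound_d2 (U : ℝ) (x : Fin 2 → Fin 2 → ℝ) :
    (U - Real.sqrt (U ^ 2 + 16)) / 2 * nsqR x ≤
      hopR (![![0, -1], ![-1, 0]] : Fin 2 → Fin 2 → ℤ) (![![0, -1], ![-1, 0]] : Fin 2 → Fin 2 → ℤ) x +
        U * dblR (![![1, 0], ![0, 1]] : Fin 2 → Fin 2 → ℕ) x := by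
  rw [nsqR_d2, dblR_d2, hopR_d2]
  set s := Real.sqrt (U ^ 2 + 16) with hs
  have hs2 : s ^ 2 = U ^ 2 + 16 := Real.sq_sqrt (by positivity)
  have hμ : 0 < U + s := add_sqrt_pos U
  have key : 2 * ((U + s) / 2) *
      (-2 * ((x 0 0 + x 1 1) * (x 0 1 + x 1 0)) + U * (x 0 0 ^ 2 + x 1 1 ^ 2) -
        (U - s) / 2 * (x 0 0 ^ 2 + x 0 1 ^ 2 + x 1 0 ^ 2 + x 1 1 ^ 2)) =
      ((U + s) / 2 * (x 0 0 + x 1 1) - 2 * (x 0 1 + x 1 0)) ^ 2 + ((U + s) / 2) ^ 2 * (x 0 0 - x 1 1) ^ 2 +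
        4 * (x 0 1 - x 1 0) ^ 2 := by
    linear_combination (((x 0 1 + x 1 0) ^ 2 + (x 0 1 - x 1 0) ^ 2) / 4) * hs2
  nlinarith [key, sq_nonneg ((U + s) / 2 * (x 0 0 + x 1 1) - 2 * (x 0 1 + x 1 0)),
    sq_nonneg ((U + s) / 2 * (x 0 0 - x 1 1)), sq_nonneg (x 0 1 - x 1 0), hμ]

/-! ## §3 The exact sector energy of the dimer: `E₀(2; 1, U; 1, 1) = (U − √(U² + 16))/2` -/

/-- **LOWER HALF**: `(U − √(U²+16))/2 ≤ E₀(hubbardRingTV 2 1 U; 1, 1)` for every rational `U` — the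
sector ground state exists, its Rayleigh quotient is the sector energy, and the real form bound of §2
applies to the real and imaginary parts of its coordinate array (adapted from the typer's
`hubbardRingTV_lowerRow_of_formBound`, with a REAL bound in place of a rational row slot). [folklore] -/
theorem le_energy (U : ℚ) :
    ((U : ℝ) - Real.sqrt ((U : ℝ) ^ 2 + 16)) / 2 ≤ Model.energy (hubbardRingTV 2 1 U) 1 1 := by
  have hF := hubbardRingTV_isSymmetric 2 1 U
  obtain ⟨ψ, hψ, hψ1, hHψ⟩ := exists_unit_eigen_sectorGroundEnergy
    (Model.hamiltonian_isHermitian hF) (a := 1) (b := 1) (by simp) (by simp)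
  change (hubbardRingTV 2 1 U).hamiltonian *ᵥ ψ =
    (((hubbardRingTV 2 1 U).energy 1 1 : ℝ) : ℂ) • ψ at hHψ
  set e := (hubbardRingTV 2 1 U).energy 1 1 with he
  obtain ⟨hn, hH⟩ := hubbardRingTV_sector_forms isSubsetEnum_d2 isSubsetEnum_d2 hoppingMatrix_d2
    hoppingMatrix_d2 card_d2_inter U hψ
  have hval : (star ψ ⬝ᵥ (hubbardRingTV 2 1 U).hamiltonian *ᵥ ψ).re = e := by
    rw [hHψ, dotProduct_smul, hψ1, smul_eq_mul, mul_one, Complex.ofReal_re]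
  have hone : normSqW (fun i j => coeffMatrix ψ ((![{0}, {1}] : Fin 2 → Finset (Fin 2)) i)
      ((![{0}, {1}] : Fin 2 → Finset (Fin 2)) j)) = 1 := by
    rw [← hn, hψ1, Complex.one_re]
  rw [hH, hopForm_eq_hopR, dblForm_eq_dblR] at hval
  rw [normSqW_eq_nsqR] at hone
  have h1 := formBound_d2 (U : ℝ)
    (fun i j => (coeffMatrix ψ ((![{0}, {1}] : Fin 2 → Finset (Fin 2)) i) ((![{0}, {1}] : Fin 2 → Finset (Fin 2)) j)).re)
  have h2 := formBound_d2 (U : ℝ)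
    (fun i j => (coeffMatrix ψ ((![{0}, {1}] : Fin 2 → Finset (Fin 2)) i) ((![{0}, {1}] : Fin 2 → Finset (Fin 2)) j)).im)
  have key : ((U : ℝ) - Real.sqrt ((U : ℝ) ^ 2 + 16)) / 2 *
      (nsqR (fun i j => (coeffMatrix ψ ((![{0}, {1}] : Fin 2 → Finset (Fin 2)) i)
          ((![{0}, {1}] : Fin 2 → Finset (Fin 2)) j)).re) +
        nsqR (fun i j => (coeffMatrix ψ ((![{0}, {1}] : Fin 2 → Finset (Fin 2)) i)
          ((![{0}, {1}] : Fin 2 → Finset (Fin 2)) j)).im)) ≤ e := by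
    linarith
  rw [hone, mul_one] at key
  exact key

/-- **UPPER HALF**: `E₀(hubbardRingTV 2 1 U; 1, 1) ≤ (U − √(U²+16))/2` — Rayleigh–Ritz at the explicit
sector vector with coordinate array `w₀₀ = w₁₁ = 2`, `w₀₁ = w₁₀ = μ = (U + √(U²+16))/2` (the exact
ground state: `hop + U·dbl = λ·nsq` on it since `λ + μ = U`, `λμ = −4`). [folklore] -/
theorem energy_le (U : ℚ) :
    Model.energy (hubbardRingTV 2 1 U) 1 1 ≤ ((U : ℝ) - Real.sqrt ((U : ℝ) ^ 2 + 16)) / 2 := by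
  set s := Real.sqrt ((U : ℝ) ^ 2 + 16) with hs
  have hs2 : s ^ 2 = (U : ℝ) ^ 2 + 16 := Real.sq_sqrt (by positivity)
  have hμ : 0 < (U : ℝ) + s := add_sqrt_pos (U : ℝ)
  -- the trial array and vector
  set w : Fin 2 → Fin 2 → ℂ := fun i j => if i = j then (2 : ℂ) else ((((U : ℝ) + s) / 2 : ℝ) : ℂ) with hw
  set ψ : Fock (Orb (Fin 2)) :=
    ofSectorArray (![{0}, {1}] : Fin 2 → Finset (Fin 2)) (![{0}, {1}] : Fin 2 → Finset (Fin 2)) w with hψdef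
  have hψ : IsInSector 1 1 ψ := isInSector_ofSectorArray isSubsetEnum_d2 isSubsetEnum_d2 _
  have hcoef : (fun i j => coeffMatrix ψ ((![{0}, {1}] : Fin 2 → Finset (Fin 2)) i)
      ((![{0}, {1}] : Fin 2 → Finset (Fin 2)) j)) = w :=
    funext fun i => funext fun j => coeffMatrix_ofSectorArray isSubsetEnum_d2 isSubsetEnum_d2 _ i j
  obtain ⟨hn, hH⟩ := hubbardRingTV_sector_forms isSubsetEnum_d2 isSubsetEnum_d2 hoppingMatrix_d2
    hoppingMatrix_d2 card_d2_inter U hψ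
  rw [hcoef] at hn hH
  -- the real and imaginary coordinate arrays of `w`
  have hre : (fun i j => (w i j).re) = fun i j : Fin 2 => if i = j then (2 : ℝ) else ((U : ℝ) + s) / 2 := by
    funext i j
    simp only [hw]
    split_ifs <;> simp
  have him : (fun i j => (w i j).im) = fun _ _ : Fin 2 => (0 : ℝ) := by
    funext i j
    simp only [hw]
    split_ifs <;> simp
  -- evaluate the three forms
  have hnsq : normSqW w = 8 + 2 * (((U : ℝ) + s) / 2) ^ 2 := by
    rw [normSqW_eq_nsqR, hre, him, nsqR_d2, nsqR_d2]
    simp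
    ring
  have hdbl : dblForm (![![1, 0], ![0, 1]] : Fin 2 → Fin 2 → ℕ) w = 8 := by
    rw [dblForm_eq_dblR, hre, him, dblR_d2, dblR_d2]
    simp
    norm_num
  have hhop : hopForm (![![0, -1], ![-1, 0]] : Fin 2 → Fin 2 → ℤ) (![![0, -1], ![-1, 0]] : Fin 2 → Fin 2 → ℤ) w =
      -16 * (((U : ℝ) + s) / 2) := by
    rw [hopForm_eq_hopR, hre, him, hopR_d2, hopR_d2]
    simp
    ring
  have hne : ψ ≠ 0 := by
    intro h0
    have h1 : (star ψ ⬝ᵥ ψ).re = 0 := by rw [h0, dotProduct_zero, Complex.zero_re]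
    rw [hn, hnsq] at h1
    nlinarith [sq_nonneg (((U : ℝ) + s) / 2)]
  refine sectorGroundEnergy_le_of_rayleigh (hubbardRingTV_hamiltonian_isHermitian 2 1 U) hψ hne ?_
  rw [hH, hn, hnsq, hdbl, hhop]
  -- `8U − 16μ = λ (8 + 2μ²)` from `λ + μ = U`, `λ μ = −4`
  have key : -16 * (((U : ℝ) + s) / 2) + (U : ℝ) * 8 =
      ((U : ℝ) - s) / 2 * (8 + 2 * (((U : ℝ) + s) / 2) ^ 2) := by
    linear_combination (((U : ℝ) + s) / 4) * hs2
  rw [key]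

/-- **THE HUBBARD DIMER, EXACTLY**: `E₀(hubbardRingTV 2 1 U; N_α = N_β = 1) = (U − √(U² + 16))/2` for
every rational `U` (the textbook two-site ground energy `(U − √(U² + 16t²))/2` at `t = 1`). [folklore] -/
theorem energy_eq (U : ℚ) :
    Model.energy (hubbardRingTV 2 1 U) 1 1 = ((U : ℝ) - Real.sqrt ((U : ℝ) ^ 2 + 16)) / 2 :=
  le_antisymm (energy_le U) (le_energy U)

/-- **General hopping `t > 0`**: `E₀(hubbardRingTV 2 t U; 1, 1) = (U − √(U² + 16t²))/2` (scale
homogeneity `E₀(L; c·t′, c·U′) = c·E₀(L; t′, U′)`, `c = t`). [folklore] -/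
theorem energy_eq_of_pos {t : ℚ} (ht : 0 < t) (U : ℚ) :
    Model.energy (hubbardRingTV 2 t U) 1 1 = ((U : ℝ) - Real.sqrt ((U : ℝ) ^ 2 + 16 * (t : ℝ) ^ 2)) / 2 := by
  have h := hubbardRingTV_energy_scale 2 ht.le 1 (U / t) 1 1
  rw [mul_one, mul_div_cancel₀ _ ht.ne'] at h
  rw [h, energy_eq]
  have ht' : (0 : ℝ) < t := by exact_mod_cast ht
  have hx : (U : ℝ) ^ 2 + 16 * (t : ℝ) ^ 2 = (t : ℝ) ^ 2 * ((((U / t : ℚ) : ℝ)) ^ 2 + 16) := by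
    push_cast
    field_simp
  rw [hx, Real.sqrt_mul (sq_nonneg _), Real.sqrt_sq ht'.le]
  push_cast
  field_simp

/-! ## §4 Both registered relaxation levels of the cell take this value on the dimer -/

/-- **`OPT_DQG(2; 1, U; 1, 1) = (U − √(U² + 16))/2`** for every rational `U`: the level-DQG programme is
exact on the dimer (two electrons; `Rows/TwoElectronSectorsExact.lean`) and the exact energy is §3's —
a CLOSED FORM for the cell's sector SDP value at all couplings. [folklore] -/
theorem pqgSectorEnergy_eq (U : ℚ) :
    Model.pqgSectorEnergy (hubbardRingTV 2 1 U) 1 1 = ((U : ℝ) - Real.sqrt ((U : ℝ) ^ 2 + 16)) / 2 := by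
  rw [hubbardRingTV_two_pqgSectorEnergy_eq_energy, energy_eq]

/-- **`OPT_DQG+S²(2; 1, U; 1) = (U − √(U² + 16))/2`** for every rational `U > 0` (the singlet-restricted
level is exact on the dimer too, `hubbardRingTV_two_pqgSingletEnergy_eq_energy`). [folklore] -/
theorem pqgSingletEnergy_eq {U : ℚ} (hU : 0 < U) :
    Model.pqgSingletEnergy (hubbardRingTV 2 1 U) 1 = ((U : ℝ) - Real.sqrt ((U : ℝ) ^ 2 + 16)) / 2 := by
  rw [hubbardRingTV_two_pqgSingletEnergy_eq_energy 1 hU, energy_eq]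

/-- **General hopping `t > 0`, level DQG**: `OPT_DQG(2; t, U; 1, 1) = (U − √(U² + 16t²))/2`. [folklore] -/
theorem pqgSectorEnergy_eq_of_pos {t : ℚ} (ht : 0 < t) (U : ℚ) :
    Model.pqgSectorEnergy (hubbardRingTV 2 t U) 1 1 =
      ((U : ℝ) - Real.sqrt ((U : ℝ) ^ 2 + 16 * (t : ℝ) ^ 2)) / 2 := by
  rw [hubbardRingTV_two_pqgSectorEnergy_eq_energy, energy_eq_of_pos ht]

/-- **The superexchange bracket of the dimer**: for `U > 0`, `−4/U ≤ E₀(2; 1, U; 1, 1) ≤ 0`, i.e.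
`−J ≤ E₀ ≤ 0` with `J = 4t²/U` at `t = 1` (from the closed form: `U·E₀ = −8/(1 + √(1 + 16/U²)) ∈ [−4, 0)`;
here by `√(U² + 16) ≤ U + 8/U`). [folklore] -/
theorem energy_mem_Icc {U : ℚ} (hU : 0 < U) :
    -4 / (U : ℝ) ≤ Model.energy (hubbardRingTV 2 1 U) 1 1 ∧ Model.energy (hubbardRingTV 2 1 U) 1 1 ≤ 0 := by
  rw [energy_eq]
  have hU' : (0 : ℝ) < U := by exact_mod_cast hU
  set s := Real.sqrt ((U : ℝ) ^ 2 + 16) with hs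
  have hs2 : s ^ 2 = (U : ℝ) ^ 2 + 16 := Real.sq_sqrt (by positivity)
  have hs0 : 0 ≤ s := Real.sqrt_nonneg _
  have hsU : (U : ℝ) ≤ s := by nlinarith
  constructor
  · -- `−4/U ≤ (U − s)/2 ⟺ s ≤ U + 8/U ⟸ s² ≤ (U + 8/U)²`
    rw [div_le_iff₀ hU', ← sub_nonneg]
    have h8 : s * (U : ℝ) ≤ (U : ℝ) ^ 2 + 8 := by nlinarith [sq_nonneg (s * U - ((U:ℝ) ^ 2 + 8)), sq_nonneg (U : ℝ)]
    nlinarith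
  · linarith

/-! ## §5 The strong-coupling constant of the dimer, exactly: `U·E₀(2; 1, U; 1, 1) → −4` -/

/-- The real-variable limit behind the dimer's strong-coupling constant:
`x·(x − √(x² + 16))/2 = −8/(1 + √(1 + 16/x²)) → −4` as `x → ∞`. [folklore] -/
theorem tendsto_mul_closedForm :
    Filter.Tendsto (fun x : ℝ => x * ((x - Real.sqrt (x ^ 2 + 16)) / 2)) Filter.atTop (nhds (-4)) := by
  have h1 : Filter.Tendsto (fun x : ℝ => (16 : ℝ) / x ^ 2) Filter.atTop (nhds 0) :=
    tendsto_const_nhds.div_atTop (Filter.tendsto_pow_atTop two_ne_zero)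
  have h2 : Filter.Tendsto (fun x : ℝ => Real.sqrt (1 + 16 / x ^ 2)) Filter.atTop (nhds 1) := by
    have h := (tendsto_const_nhds (x := (1 : ℝ))).add h1
    rw [add_zero] at h
    have h' := h.sqrt
    rwa [Real.sqrt_one] at h'
  have h3 : Filter.Tendsto (fun x : ℝ => (-8 : ℝ) / (1 + Real.sqrt (1 + 16 / x ^ 2))) Filter.atTop (nhds (-4)) := by
    have h := (tendsto_const_nhds (x := (-8 : ℝ))).div ((tendsto_const_nhds (x := (1 : ℝ))).add h2)
      (by norm_num)
    convert h using 2 <;> norm_num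
  refine h3.congr' ?_
  filter_upwards [Filter.Ioi_mem_atTop (0 : ℝ)] with x hx
  have hx' : 0 < x := hx
  have hsq : Real.sqrt (x ^ 2 + 16) = x * Real.sqrt (1 + 16 / x ^ 2) := by
    have hx2 : x ^ 2 + 16 = x ^ 2 * (1 + 16 / x ^ 2) := by field_simp
    rw [hx2, Real.sqrt_mul (sq_nonneg _), Real.sqrt_sq hx'.le]
  set r := Real.sqrt (1 + 16 / x ^ 2) with hr
  have hr0 : 0 ≤ r := Real.sqrt_nonneg _
  have hr2 : r ^ 2 = 1 + 16 / x ^ 2 := Real.sq_sqrt (by positivity)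
  have h1r : (1 : ℝ) + r ≠ 0 := by positivity
  rw [hsq, div_eq_iff h1r]
  have key : x ^ 2 * (1 - r) * (1 + r) = -16 := by
    have : x ^ 2 * (1 - r) * (1 + r) = x ^ 2 * (1 - r ^ 2) := by ring
    rw [this, hr2]
    field_simp
    ring
  nlinarith [key]

/-- **`lim_{U → ∞} U·E₀(hubbardRingTV 2 1 U; 1, 1) = −4`** along rational `U` — the dimer's strong-coupling
constant (`−4·h(2)` in the cell's convention `h(L) = −lim U·E₀/4t²`, with the two-site singlet value
`h(2) = −⟨S₁·S₂ − ¼⟩ = 1`, i.e. `E₀ ≈ −J`, `J = 4t²/U`), read off the closed form; compare the typer's T-K0-4 `U·E₀(4; U) → −12`. [folklore] -/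
theorem tendsto_mul_energy_two :
    Filter.Tendsto (fun U : ℚ => (U : ℝ) * Model.energy (hubbardRingTV 2 1 U) 1 1) Filter.atTop (nhds (-4)) := by
  have h := tendsto_mul_closedForm.comp (tendsto_ratCast_atTop_iff.2 Filter.tendsto_id)
  refine h.congr fun U => ?_
  simp only [Function.comp_apply, id_eq, energy_eq]

/-- **… and the same for both relaxation levels** (they are exact on the dimer):
`U·OPT_DQG(2; 1, U; 1, 1) → −4` along rational `U`. [folklore] -/
theorem tendsto_mul_pqgSectorEnergy_two :
    Filter.Tendsto (fun U : ℚ => (U : ℝ) * Model.pqgSectorEnergy (hubbardRingTV 2 1 U) 1 1) Filter.atTop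
      (nhds (-4)) := by
  refine tendsto_mul_energy_two.congr fun U => ?_
  rw [hubbardRingTV_two_pqgSectorEnergy_eq_energy]

/-! ## §6 Every sector of the dimer is solved exactly by the level-DQG programme -/

/-- **ON THE HUBBARD DIMER THE LEVEL-DQG PROGRAMME HAS NO GAP IN ANY SECTOR**: for every `t, U` and every
`(a, b)` with `a, b ≤ 2`, `OPT_DQG(hubbardRingTV 2 t U; a, b) = E₀(hubbardRingTV 2 t U; a, b)` — the nine
sectors are the vacuum / the full band (gen 38's `Rows/HubbardRingTVVacuumSector.lean`), one electron / one
hole (`Rows/OneElectronSectorsExact.lean`) and two electrons = two holes (`Rows/TwoElectronSectorsExact.lean`).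
[folklore] -/
theorem pqgSectorEnergy_eq_energy_all (t U : ℚ) {a b : ℕ} (ha : a ≤ 2) (hb : b ≤ 2) :
    Model.pqgSectorEnergy (hubbardRingTV 2 t U) a b = Model.energy (hubbardRingTV 2 t U) a b := by
  have h1 := hubbardRingTV_pqgSectorEnergy_eq_energy_oneElectron (L := 2) (by omega) t U
  have hh := hubbardRingTV_pqgSectorEnergy_eq_energy_oneHole (L := 2) (by omega) t U
  norm_num at hh
  interval_cases a <;> interval_cases b
  · rw [hubbardRingTV_pqgSectorEnergy_vacuum, hubbardRingTV_energy_vacuum]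
  · exact h1.2
  · exact hubbardRingTV_pqgSectorEnergy_eq_energy_two 2 t U rfl (by omega) (by omega)
  · exact h1.1
  · exact hubbardRingTV_pqgSectorEnergy_eq_energy_two 2 t U rfl (by omega) (by omega)
  · exact hh.1
  · exact hubbardRingTV_pqgSectorEnergy_eq_energy_two 2 t U rfl (by omega) (by omega)
  · exact hh.2
  · rw [hubbardRingTV_pqgSectorEnergy_full, hubbardRingTV_energy_full]

end Dimer

end Summit.Ventures.CertifiedQuantumChemistry

end
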